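import Literature.AnabelianGeometry.SemiGraphs.FiniteEtaleCoveringDictionary
import Literature.AnabelianGeometry.SemiGraphs.FiniteEtaleCoveringGlobalDef
import Literature.AnabelianGeometry.SemiGraphs.GraphOfAnabelioidsGalois
import Literature.AnabelianGeometry.Anabelioids.FiniteEtaleLocalDictionaryStabilizer
import HarnessLib

/-!
# The finite étale covering dictionary ([SemiAnbd] §2) — proof of (D1), decomposition groups

Mochizuki, *Semi-graphs of anabelioids*, Publ. RIMS **42** (2006), §2 p. 23 (Definition 2.2 (i):
the finite étale covering `𝒢′ → 𝒢` attached to `A ∈ B(𝒢)` is DEFINED by `B(𝒢′) = B(𝒢)_{/A}`) and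
Remark 2.2.1 p. 24 ("the image … is equal to the stabilizer"), [SGA1 V].  abc-iut cell, layer L3,
DISCHARGE-L3 §G row G30, fact (D1) `covering_decompositionGroup` of abc-iut-L3-d3's
`FiniteEtaleCoveringDictionary.lean`, in the form ruled by TREE-HEALTH RQ11 / ruling ζ2 (the GLOBAL
clause «`φ^* ≅ (A × −) ⋙ α` for an equivalence `α : B(𝒢)_{/A} ⥲ B(𝒢′)`», abc-iut-L3-d3's
`Hom.IsGlobalCoveringOf`, is a hypothesis: the local description `Hom.IsFiniteEtaleCoveringOf` alone
does not pin the covering's gluing and (D1) is false without it — audit A-L6d4-G30-F1, the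
`S₃/A₃` double-loop witness).

PROOF-ONLY file (abc-iut-L6-d4; no definitions).  Content:

* `covering_decompositionGroup_of_isBObjCovering` — for connected `𝒢`, `𝒢′`, a morphism
  `φ : 𝒢′ → 𝒢` which is GLOBALLY the covering attached to `A` (abc-iut-L3-d3's
  `Hom.IsGlobalCoveringOf`: `φ^* ≅ (A × −) ⋙ α` for an equivalence `α : B(𝒢)_{/A} ⥲ B(𝒢′)`), a
  vertex `v′` of `𝒢′` with basepoint `F′` of `𝒢′_{v′}`, any basepoint `F` of `𝒢_v` (`v = φ v′`) and
  `e : φ_{v′}^* ⋙ F′ ≅ F`: the homomorphism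
  `ι = Aut(ρ_v ⋙ e) ∘ π₁(φ^*) : Π_{𝒢′} = Aut(ρ′_{v′} ⋙ F′) → Π_𝒢 = Aut(ρ_v ⋙ F)` is INJECTIVE and its
  image is the STABILISER of a point `x₀ ∈ F(A_v)`.

The argument is abc-iut-L6-t17's local dictionary for ABSTRACT Galois categories
(`pi1Map_injective_of_star_comp`, `range_pi1Map_eq_stabilizer`, `FiniteEtaleLocalDictionary*.lean`)
applied to `C := B(𝒢)`, `D := B(𝒢′)` (Galois categories by abc-iut-L3-t9's `galoisCategory_bObj`,
basepoints `ρ_v ⋙ F` fibre functors by `fiberFunctor_ρ`), `Q := φ^*`; since those lemmas want the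
basepoint of `D` valued in `FintypeCat.{max u v₁}` (the morphism universe of `B(𝒢′)`) while the
cell's basepoints are valued in `FintypeCat.{v₁}`, the statement is transported along the universe
switch `FintypeCat.uSwitch` (an equivalence; right whiskering with it is fully faithful, so it
induces isomorphisms `Aut K ≃* Aut (K ⋙ uSwitch)` compatible with `π₁(φ^*)`, with conjugation by
isomorphisms of basepoints, and with the actions on fibres via `uSwitchEquiv`).

Nothing here takes a side on [IUTchIII] Cor. 3.12; typed ≠ discharged.
-/

namespace Literature.AnabelianGeometry.SemiGraphs

open CategoryTheory CategoryTheory.Limits CategoryTheory.PreGaloisCategory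
open Literature.AnabelianGeometry.Anabelioids

universe w v₁ u₁ u


namespace SemiGraphOfAnabelioids

variable {𝒢 𝒢' : SemiGraphOfAnabelioids.{v₁, u₁, u}}

/-- **(D1) Decomposition groups along a finite étale covering** ([SemiAnbd] §2 p. 23, Rem. 2.2.1
p. 24, [SGA1 V]), under the GLOBAL clause `φ^* ≅ (A × −) ⋙ α` (p. 23: `B(𝒢′) := B(𝒢)_{/A}`): for
connected `𝒢`, `𝒢′`, `φ : 𝒢′ → 𝒢` with `φ.IsGlobalCoveringOf A` (an equivalence
`α : B(𝒢)_{/A} ⥤ B(𝒢′)` with `φ^* ≅ Over.star A ⋙ α`, abc-iut-L3-d3 `FiniteEtaleCoveringGlobal.lean`), a vertex `v′` of `𝒢′` with basepoint `F′`, any basepoint `F` of `𝒢_v`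
(`v = φ v′`) and `e : φ_{v′}^* ⋙ F′ ≅ F`, the homomorphism
`ι = Aut(ρ_v ⋙ e) ∘ π₁(φ^*) : Π_{𝒢′} → Π_𝒢` is injective with image the stabiliser of a point of
the fibre `F(A_v)`.  (abc-iut-L6-t17's abstract local dictionary at `C := B(𝒢)`, `D := B(𝒢′)`,
transported along `FintypeCat.uSwitch`.) [cite: MochizukiSemiAnbd2006, Rem. 2.2.1 p.24] -/
theorem covering_decompositionGroup_of_isBObjCovering (h𝒢 : 𝒢.IsConnected)
    (h𝒢' : 𝒢'.IsConnected) (φ : Hom 𝒢' 𝒢) (A : 𝒢.BObj)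
    (hB : φ.IsGlobalCoveringOf A)
    (v' : 𝒢'.graph.Vertex) (F' : 𝒢'.V v' ⥤ FintypeCat.{v₁}) [FiberFunctor F']
    (F : 𝒢.V (φ.base.vertexMap v') ⥤ FintypeCat.{v₁}) [FiberFunctor F]
    (e : (φ.φV v').pullback ⋙ F' ≅ F) :
    ∃ x₀ : (𝒢.ρ (φ.base.vertexMap v') ⋙ F).obj A,
      Function.Injective
          ((Aut.autMulEquivOfIso (Functor.isoWhiskerLeft (𝒢.ρ (φ.base.vertexMap v')) e)
              ).toMonoidHom.comp (pi1Map φ.pullbackFunctor (𝒢'.ρ v' ⋙ F'))) ∧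
        ((Aut.autMulEquivOfIso (Functor.isoWhiskerLeft (𝒢.ρ (φ.base.vertexMap v')) e)
              ).toMonoidHom.comp (pi1Map φ.pullbackFunctor (𝒢'.ρ v' ⋙ F'))).range =
          MulAction.stabilizer (𝒢.Pi (φ.base.vertexMap v') F) x₀ := by
  letI := 𝒢.preGaloisCategory_bObj
  letI := 𝒢'.preGaloisCategory_bObj
  letI := 𝒢.galoisCategory_bObj h𝒢
  letI := 𝒢'.galoisCategory_bObj h𝒢'
  obtain ⟨_, α, hα, ⟨eB⟩⟩ := hB
  haveI := hα
  -- notation: `Q = φ^*`, the basepoints `K′ = ρ′_{v′} ⋙ F′` of `B(𝒢′)` and `K = ρ_v ⋙ F` of `B(𝒢)`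
  let Q : 𝒢.BObj ⥤ 𝒢'.BObj := φ.pullbackFunctor
  let K' : 𝒢'.BObj ⥤ FintypeCat.{v₁} := 𝒢'.ρ v' ⋙ F'
  let K : 𝒢.BObj ⥤ FintypeCat.{v₁} := 𝒢.ρ (φ.base.vertexMap v') ⋙ F
  let eK : Q ⋙ K' ≅ K := Functor.isoWhiskerLeft (𝒢.ρ (φ.base.vertexMap v')) e
  let ι : Aut K' →* Aut K := (Aut.autMulEquivOfIso eK).toMonoidHom.comp (pi1Map Q K')
  change ∃ x₀ : K.obj A, Function.Injective ι ∧ ι.range = MulAction.stabilizer (Aut K) x₀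
  -- the basepoint of `B(𝒢′)` through `v′`, moved to the universe the abstract dictionary wants
  haveI : FiberFunctor K' := 𝒢'.fiberFunctor_ρ h𝒢' v' F'
  let U := FintypeCat.uSwitch.{v₁, max u v₁}
  let Fs : 𝒢'.BObj ⥤ FintypeCat.{max u v₁} := K' ⋙ U
  haveI : FiberFunctor Fs := FiberFunctor.comp_right _
  let β : Q ⋙ Fs ≅ K ⋙ U := Functor.isoWhiskerRight eK U
  -- a point of the fibre of the terminal object `α(A = A)`
  have hT : IsTerminal (α.obj (Over.mk (𝟙 A))) := Over.mkIdTerminal.isTerminalObj α _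
  obtain ⟨eT⟩ := nonempty_equiv_fiber_terminal_punit Fs
  let t : Fs.obj (α.obj (Over.mk (𝟙 A))) := Fs.map (hT.from (⊤_ 𝒢'.BObj)) (eT.symm PUnit.unit)
  -- the abstract dictionary (abc-iut-L6-t17)
  have hinj : Function.Injective (pi1Map Q Fs) := pi1Map_injective_of_star_comp α eB Fs
  have hrange := range_pi1Map_eq_stabilizer α eB Fs β t
  let xs : (K ⋙ U).obj A := β.hom.app A
    (Fs.map (α.map ((Over.forgetAdjStar A).unit.app (Over.mk (𝟙 A))) ≫ eB.inv.app A) t)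
  let ιs : Aut Fs →* Aut (K ⋙ U) := (Aut.autMulEquivOfIso β).toMonoidHom.comp (pi1Map Q Fs)
  change ιs.range = MulAction.stabilizer (Aut (K ⋙ U)) xs at hrange
  -- right whiskering with the (fully faithful) universe switch on automorphism groups
  let hU : U.FullyFaithful := Functor.FullyFaithful.ofFullyFaithful U
  let W' : Aut K' ≃* Aut Fs := (hU.whiskeringRight 𝒢'.BObj).autMulEquivOfFullyFaithful K'
  let W : Aut K ≃* Aut (K ⋙ U) := (hU.whiskeringRight 𝒢.BObj).autMulEquivOfFullyFaithful K
  have hW'app : ∀ (σ : Aut K') (X : 𝒢'.BObj), (W' σ).hom.app X = U.map (σ.hom.app X) :=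
    fun _ _ => rfl
  have hWapp : ∀ (σ : Aut K) (X : 𝒢.BObj), (W σ).hom.app X = U.map (σ.hom.app X) :=
    fun _ _ => rfl
  have hWsmul : ∀ (σ : Aut K) (y : (K ⋙ U).obj A),
      (K.obj A).uSwitchEquiv (W σ • y) = σ • (K.obj A).uSwitchEquiv y := by
    intro σ y
    rw [mulAction_def, mulAction_def, hWapp]
    exact (FintypeCat.uSwitchEquiv_naturality (σ.hom.app A) y).symm
  -- compatibility of `ι` with the universe transport
  have hcomp : ∀ σ : Aut K', ιs (W' σ) = W (ι σ) := by
    intro σ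
    refine Iso.ext (NatTrans.ext (funext fun X => ?_))
    change (β.inv.app X ≫ (pi1Map Q Fs (W' σ)).hom.app X ≫ β.hom.app X) =
      (W (ι σ)).hom.app X
    rw [hWapp, pi1Map_hom_app, hW'app]
    change U.map (eK.inv.app X) ≫ U.map (σ.hom.app (Q.obj X)) ≫ U.map (eK.hom.app X) =
      U.map (eK.inv.app X ≫ (pi1Map Q K' σ).hom.app X ≫ eK.hom.app X)
    rw [pi1Map_hom_app, U.map_comp, U.map_comp]
    rfl
  refine ⟨(K.obj A).uSwitchEquiv xs, ?_, ?_⟩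
  · -- injectivity
    have h2 : Function.Injective (fun σ => ιs (W' σ)) :=
      ((Aut.autMulEquivOfIso β).injective.comp hinj).comp W'.injective
    intro σ₁ σ₂ h
    apply h2
    change ιs (W' σ₁) = ιs (W' σ₂)
    rw [hcomp, hcomp]
    exact congrArg W h
  · -- the image is the stabiliser
    ext ρ
    constructor
    · rintro ⟨σ, rfl⟩
      rw [MulAction.mem_stabilizer_iff]
      have hmem : ιs (W' σ) ∈ MulAction.stabilizer (Aut (K ⋙ U)) xs := by
        rw [← hrange]; exact ⟨W' σ, rfl⟩
      rw [MulAction.mem_stabilizer_iff, hcomp] at hmem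
      conv_rhs => rw [← hmem]
      rw [hWsmul]
    · intro hρ
      rw [MulAction.mem_stabilizer_iff] at hρ
      have hmem : W ρ ∈ MulAction.stabilizer (Aut (K ⋙ U)) xs := by
        rw [MulAction.mem_stabilizer_iff]
        apply (K.obj A).uSwitchEquiv.injective
        rw [hWsmul]
        exact hρ
      rw [← hrange] at hmem
      obtain ⟨τ, hτ⟩ := hmem
      obtain ⟨σ, rfl⟩ := W'.surjective τ
      refine ⟨σ, W.injective ?_⟩
      rw [← hcomp]
      exact hτ

end SemiGraphOfAnabelioids

end Literature.AnabelianGeometry.SemiGraphs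

namespace Literature.AnabelianGeometry.SemiGraphs

namespace SemiGraphOfAnabelioids

universe v₁ u₁ u in
/-- **(D1) `covering_decompositionGroup` DISCHARGED** (abc-iut-L3-d3's dictionary v2, i.e. under the
global clause `Hom.IsGlobalCoveringOf` of ruling ζ2): [SemiAnbd] §2 p. 23 / Rem. 2.2.1 p. 24 — along
the finite étale covering attached to `A`, `Π_{𝒢′} → Π_𝒢` is injective with image the decomposition
group (stabiliser) of a point of the fibre of `A`.  Wrapper around
`covering_decompositionGroup_of_isBObjCovering`. [cite: MochizukiSemiAnbd2006, Rem. 2.2.1 p.24] -/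
theorem covering_decompositionGroup_holds : covering_decompositionGroup.{v₁, u₁, u} := by
  intro 𝒢 𝒢' φ A h𝒢 h𝒢' _ hB v' F' _ F _ e
  exact covering_decompositionGroup_of_isBObjCovering h𝒢 h𝒢' φ A hB v' F' F e

end SemiGraphOfAnabelioids

end Literature.AnabelianGeometry.SemiGraphs
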